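import Summits.Parity.BatemanHorn.Theses.IsogenyRedei

/-!
# Skeleton line `cofactor-root-discrepancy` for crux `IsogenyRedei.SplitBlockJacobi` (stmt-Parity-11583)

Crux (FIXED, by name): `SplitBlockJacobi` =
`∀ θ ∈ (1/2,1), J_θ(x) := Σ_{t ≤ x} Σ_{(Q,Q′) ∈ pf(t²+1)², x^θ < Q < Q′} (Q|Q′) = o(x)`.

## The line (crux idea `cofactor-root-discrepancy`, ideator 3, round 1; triage r1: 3 × pass,
## "merge with `prime-pair-crt-corner`: one pair-Poisson line, tier 1 = the corner")

LEVER. Sum over the PRIME PAIR, not over `t` (pair-side Fubini, = the disprover's §0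
`J_eq_sum_pairs_mul_card`):  `J_θ(x) = Σ_{(Q,Q′) ∈ P_θ(x)} (Q|Q′) · A_{QQ′}(x)` with
`A_q(x) := #{1 ≤ t ≤ x : q ∣ t²+1}` (the COUNT OF SMALL ROOTS of `-1 (mod q)`) and `P_θ(x)` the FREE
set of prime pairs `Q ≡ Q′ ≡ 1 (4)`, `x^θ < Q < Q′`, `QQ′ ≤ x²+1` (`stub_pairForm`). Split the count
into its expectation and its discrepancy, `A_q(x) = 4x/q + disc_q(x)`:

* `E(x) := Σ_P (Q|Q′)·4x/(QQ′)` — the EXPECTED part, a bilinear sum of Legendre symbols over two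
  free prime variables: `o(x)` (`stub_expectedPart`; TRUE — the multiplicative large sieve for the
  Legendre characters `(·|Q)`, `Q ~ P₁` (tree: `Literature.NumberTheory.Sieve.largeSieve_character_nat`)
  saves in every box `P₂ ≥ P₁ log⁵x`, the near-diagonal boxes have total mass `O(x loglog x / log x)`;
  Heath-Brown's quadratic large sieve (Acta Arith. 72, 1995) gives the power saving `x^{1−θ/2+ε}` but
  is NOT needed for `o(x)`).  N.B. Disproof §H: `E` really is `≍ −x^{1−θ/2}/log²x` (Chebyshev bias of
  generic pairs), and `D` carries the opposite secular term — harmless for `o(x)`, fatal for any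
  reading "`D ≪ √N`".
* `D(x) := Σ_P (Q|Q′)·disc_{QQ′}(x)` — the `(Q|Q′)`-weighted DISCREPANCY of the small roots of `-1`
  to the moduli `q = QQ′ > x^{2θ} > x` (each `A_q(x) ∈ {0,…,4}`, one period at most).  TIER MAP by the
  cofactor `m = (t²+1)/q = x^μ`, i.e. `q = x^{2−μ}`:
  - SMALL cofactor `m < x^μ` (`q > x^{2−μ}`): vanishing mass — `Σ A_q ≤ C·μ·x` by the upper-bound
    sieve along the `ρ(m)` root classes of `m` (card `split-mass-middle-prime`'s device in the `m`
    variable; `Σ_{m ≤ x^μ} ρ(m)/m = 𝔠 μ log x + O(1)`), and `4x Σ 1/(QQ′) ≤ C μ x` — peel it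
    (`stub_smallCofactorTail`, TRUE, sieve bookkeeping);
  - BULK `q ≤ x^{2−μ}`: smooth the `t`-cutoff (cost `O(ηx)`: ≤ 3 pairs per `t`, Disproof §C
    `card_bigFactors_le_three`), Poisson in `t` modulo `q`:
    `A^w_q(x) − 4xŵ(0)/q = (x/q) Σ_{h ≠ 0} ŵ(hx/q) S(h,q)`, `S(h,q) = Σ_{ν² ≡ −1 (q)} e(hν/q)`
    (the ROOT WEYL SUM; by CRT = card 1's Kloosterman point `r·Q̄′/Q + r′·Q̄/Q′`), harmonics
    `0 < |h| ≤ H = (q/x)·x^{ε}`, separate the weight by Mellin, cut `(Q,Q′)` into dyadic boxes: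
    `D_bulk = o(x)` follows from a bound `x^{1−ε₀}`, uniform in `0 < |h| ≤ P₁P₂x^{ε₀−1}`, for the
    TWISTED ROOT WEYL SUMS `T_h(P₁,P₂) = Σ_{Q~P₁} Σ_{Q′~P₂} (Q|Q′) S(h, QQ′)` over primes `≡ 1 (4)`
    (`stub_poissonReduction : TierWeylBound θ μ → |D_bulk| ≤ εx`, TRUE, analytic bookkeeping).
  - THE BET `TierWeylBound θ μ` (card's `TwistedRootWeylBound`, = card 1's `MixedBilinear` at the
    corner): with `N ≍ P₁P₂ ≤ x^{2−μ}` terms the bound `x^{1−ε₀}` is a SAVING `N^{(1−μ)/(2−μ)+}`: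
    `→ N^{0+}` at the corner `μ → 1` (any power saving; Heath-Brown duality × DFI-1997 amplification
    is the engine on file), `= N^{1/4}` at `μ = 2/3`, `→ N^{1/2}` as `μ → 0`.  PLANNER'S FINDING
    (recorded in the line card): `N^{1/4}` is EXACTLY the ceiling of every method blind to the
    coefficients — for the kernel `K = ((Q|Q′)S(h,QQ′))` with unit-size entries the cut norm is
    `‖K‖_{∞→1} ≥ c·N^{3/4}` (Khintchine on a random sign pattern) — so the tiers `μ < 2/3` can only
    be reached through the arithmetic of the prime indicator (Vaughan/Heath-Brown identity in `Q`,
    `Q′` ⇒ multilinear Kloosterman-fraction sums, Bettin–Chandee) and need NEAR-square-root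
    cancellation as `μ → 0`.  Hence two stubs: `stub_weylShallow` (`2/3 ≤ μ < 1`, saving `≤ N^{1/4}`,
    contains the corner = tier 1 = card 1) and `stub_weylDeep` (`0 < μ < 2/3`, HARDEST, the line's
    exposure; numerics: `|T_h|/√N ≤ 3.45` to `N = 8.8·10⁶`, triage r1-2/r1-3, kit j008680).

`SplitBlockJacobi_of` composes the six stubs into the crux BY NAME (kernel-checked, no `sorry`):
given `c > 0` take `ε = c/3`; `stub_smallCofactorTail` gives `μ`; `stub_weylShallow`/`stub_weylDeep`
(case `μ ≥ 2/3` or not) give `TierWeylBound θ μ`; `stub_poissonReduction` bounds the bulk,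
`stub_expectedPart` the expectation; `stub_pairForm` + `Σ_P = Σ_{q ≤ x^{2−μ}} + Σ_{q > x^{2−μ}}`
and the triangle inequality give `|J_θ(x)| ≤ c·x` eventually.

## Disproof used (cdisprove v1–v5, evidence 20260815T221831Z…231006Z; `Disproof.lean` is NOT mounted
## in this jail and not published under `Cruxes/`; read through its evidence notes; no `Negative/*` landed)
* §0 `J_eq_sum_pairs_mul_card` (modulus-side Fubini) — IS `stub_pairForm` (restated over this file's
  `pairs`, with the `≡ 1 (4)` filter that makes `ρ(QQ′) = 4` exact; hence `4 ≤ x`).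
* §A load-bearing analysis: `θ < 1` not load-bearing (`splitBlockJacobi_iff_withoutUpper`) — the
  stubs never use `θ < 1` except to pass it on; `1/2 < θ` cannot be dropped to `θ = 0`
  (`not_SplitBlockJacobiWithoutLower`, near-miss, `J₀(x)/x → c₀ = −0.429`) — the line USES `1/2 < θ`
  at `stub_poissonReduction` (`q = QQ′ > x^{2θ} > x`: one period, `H = q/x ≥ 1` harmonics) and at
  `stub_smallCofactorTail` (`≤ 3` big primes); at `θ = 0` the expected part itself is `c₀x ≠ o(x)`.
* §C tightness (`card_bigFactors_le_three`, `abs_J_le : |J_θ(x)| ≤ 9x`, `isBigO_J`) — used inside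
  the smoothing step of `stub_poissonReduction`; no stub claims more than `o(x)` for `J`.
* §D (Aurifeuillian sign-coherent families, `jacobiSym_aur_*`): the refuted strengthening "signs
  equidistribute along algebraic families" is not an instance of any stub (all stubs average over
  the free pair set; a one-parameter family has `O(√x)` pairs).
* §F (SL₂ spin form, one point per horocycle when `B > x`) — this is WHY the line leaves the
  `t`-side: on the pair side thinness is the event "small root", paid for with `H = q/x` harmonics.
* §H (Chebyshev second-order structure) — see the `E`-bullet; `stub_expectedPart` asks only `o(x)`.
* Refuted strengthening (numerical, `theta0_tables.md`): `J_θ = O(x^{1/2+ε}) ∀ θ ∈ (0,1)` is false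
  below `1/2` — no stub is stated below `θ = 1/2`.
* Negatives index (`ledger negatives --problem Parity`, 2026-08-16): stmt-Parity-14832, 9541, 4218
  (GHL) — unrelated; no stub is an instance.
-/

set_option linter.dupNamespace false

noncomputable section

open Finset Filter

namespace Summit.Parity.BatemanHorn.Cruxes.SplitBlockJacobi.CofactorRootDiscrepancy

/-! ### §1 Vocabulary (concrete finite sums over Mathlib; nothing posited) -/

/-- `J_θ(x)`: the crux's double sum, VERBATIM the body of `IsogenyRedei.SplitBlockJacobi`. -/
def J (θ : ℝ) (x : ℕ) : ℝ :=
  ∑ t ∈ Finset.Icc 1 x, ∑ q ∈ ((t ^ 2 + 1).primeFactors ×ˢ (t ^ 2 + 1).primeFactors).filter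
    (fun q : ℕ × ℕ => (x : ℝ) ^ θ < (q.1 : ℝ) ∧ q.1 < q.2), (jacobiSym (q.1 : ℤ) q.2 : ℝ)

/-- The FREE pair set `P_θ(x)`: prime pairs `Q ≡ Q′ ≡ 1 (mod 4)`, `x^θ < Q < Q′`, `QQ′ ≤ x²+1`
(both coordinates `< x²+2`, so a genuine `Finset`). For `x ≥ 4` these are exactly the pairs that
can occur in `J_θ(x)` (an odd prime dividing `t²+1` is `≡ 1 (mod 4)`). -/
def pairs (θ : ℝ) (x : ℕ) : Finset (ℕ × ℕ) :=
  (Finset.range (x ^ 2 + 2) ×ˢ Finset.range (x ^ 2 + 2)).filter (fun q : ℕ × ℕ =>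
    q.1.Prime ∧ q.2.Prime ∧ q.1 % 4 = 1 ∧ q.2 % 4 = 1 ∧ (x : ℝ) ^ θ < (q.1 : ℝ) ∧ q.1 < q.2 ∧
      q.1 * q.2 ≤ x ^ 2 + 1)

/-- `A_q(x) = #{1 ≤ t ≤ x : q ∣ t²+1}` — the number of SMALL roots of `-1` modulo `q`
(for `q > x`: at most one period, so `A_q(x) ≤ ρ(q)`, `= 4` for `q = QQ′` as above). -/
def rootCount (q x : ℕ) : ℕ := ((Finset.Icc 1 x).filter (fun t : ℕ => q ∣ t ^ 2 + 1)).card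

/-- The root DISCREPANCY `disc_q(x) := A_q(x) − 4x/q` (expected count `x·ρ(q)/q`, `ρ(QQ′) = 4`). -/
def disc (q x : ℕ) : ℝ := (rootCount q x : ℝ) - 4 * (x : ℝ) / (q : ℝ)

/-- `E_θ(x) := Σ_{(Q,Q′) ∈ P_θ(x)} (Q|Q′) · 4x/(QQ′)` — the EXPECTED part (free bilinear
Legendre sum, weights `4x/(QQ′) < 4`). -/
def Epart (θ : ℝ) (x : ℕ) : ℝ :=
  ∑ q ∈ pairs θ x, (jacobiSym (q.1 : ℤ) q.2 : ℝ) * (4 * (x : ℝ) / ((q.1 * q.2 : ℕ) : ℝ))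

/-- `D^{bulk}_{θ,μ}(x) := Σ_{(Q,Q′) ∈ P_θ(x), QQ′ ≤ x^{2−μ}} (Q|Q′) · disc_{QQ′}(x)` — the weighted
root discrepancy over the BULK (cofactor `m = (t²+1)/(QQ′) ≳ x^μ`). -/
def Dbulk (θ μ : ℝ) (x : ℕ) : ℝ :=
  ∑ q ∈ (pairs θ x).filter (fun q : ℕ × ℕ => ((q.1 * q.2 : ℕ) : ℝ) ≤ (x : ℝ) ^ (2 - μ)),
    (jacobiSym (q.1 : ℤ) q.2 : ℝ) * disc (q.1 * q.2) x

/-- `D^{tail}_{θ,μ}(x) := Σ_{(Q,Q′) ∈ P_θ(x), QQ′ > x^{2−μ}} (Q|Q′) · disc_{QQ′}(x)` — the SMALL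
cofactor tail (`m < 2x^μ`), peeled off by a mass bound. -/
def Dtail (θ μ : ℝ) (x : ℕ) : ℝ :=
  ∑ q ∈ (pairs θ x).filter (fun q : ℕ × ℕ => ¬ ((q.1 * q.2 : ℕ) : ℝ) ≤ (x : ℝ) ^ (2 - μ)),
    (jacobiSym (q.1 : ℤ) q.2 : ℝ) * disc (q.1 * q.2) x

/-- The ROOT WEYL SUM `S(h,q) := Σ_{ν mod q, ν² ≡ −1 (q)} e(hν/q)`. For `q = QQ′` it factors through
CRT as `Σ_{r,r′} e(h(r·Q̄′/Q + r′·Q̄/Q′))` (card `prime-pair-crt-corner`'s Kloosterman point). -/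
def rootWeylSum (h : ℤ) (q : ℕ) : ℂ :=
  ∑ ν ∈ (Finset.range q).filter (fun ν : ℕ => q ∣ ν ^ 2 + 1),
    Complex.exp (2 * Real.pi * Complex.I * (h : ℂ) * (ν : ℂ) / (q : ℂ))

/-- The TWISTED ROOT WEYL SUM over a box of primes `≡ 1 (mod 4)`,
`T_h((P₁,P₁'] × (P₂,P₂']) := Σ_{Q ∈ (P₁,P₁']} Σ_{Q′ ∈ (P₂,P₂']} (Q|Q′) · S(h, QQ′)`
(terms with `Q = Q′` vanish since `(Q|Q) = 0`; the coefficients are the ARITHMETIC ones — prime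
indicators on intervals — on purpose: for general bounded coefficients no bound better than
`N^{3/4}` can hold, see the module docstring). -/
def twistedSum (h : ℤ) (P₁ P₁' P₂ P₂' : ℕ) : ℂ :=
  ∑ Q ∈ (Finset.Ioc P₁ P₁').filter (fun Q : ℕ => Q.Prime ∧ Q % 4 = 1),
    ∑ Q' ∈ (Finset.Ioc P₂ P₂').filter (fun Q' : ℕ => Q'.Prime ∧ Q' % 4 = 1),
      (jacobiSym (Q : ℤ) Q' : ℂ) * rootWeylSum h (Q * Q')

/-- **`TierWeylBound θ μ`** — the needed bilinear estimate down to cofactor tier `μ` (the card's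
`TwistedRootWeylBound` with its tier map made explicit): for `x ≥ x₀`, every box of dyadic type with
`x^θ ≤ 2P₁`, `P₁ ≤ P₂`, `P₁P₂ ≤ x^{2−μ}` (so `N ≍ P₁P₂` terms), every sub-interval pair, and every
frequency `0 < |h| ≤ P₁P₂·x^{ε₀−1}` (`= (q/x)·x^{ε₀}`, the harmonics Poisson produces):
`|T_h| ≤ x^{1−ε₀}` — a saving `N^{(1−μ)/(2−μ) + ε₀/(2−μ)}` over the trivial bound at the top tier. -/
def TierWeylBound (θ μ : ℝ) : Prop :=
  ∃ ε₀ : ℝ, 0 < ε₀ ∧ ∃ x₀ : ℕ, ∀ x : ℕ, x₀ ≤ x → ∀ P₁ P₁' P₂ P₂' : ℕ,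
    (x : ℝ) ^ θ ≤ 2 * (P₁ : ℝ) → P₁ ≤ P₁' → P₁' ≤ 2 * P₁ → P₁ ≤ P₂ → P₂ ≤ P₂' → P₂' ≤ 2 * P₂ →
      ((P₁ * P₂ : ℕ) : ℝ) ≤ (x : ℝ) ^ (2 - μ) →
        ∀ h : ℤ, h ≠ 0 → (|h| : ℝ) ≤ ((P₁ * P₂ : ℕ) : ℝ) * (x : ℝ) ^ (ε₀ - 1) →
          ‖twistedSum h P₁ P₁' P₂ P₂'‖ ≤ (x : ℝ) ^ (1 - ε₀)

/-! ### §2 The statements of the line (named `Prop`s) -/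

/-- STATEMENT 1 — pair-side Fubini: `J_θ(x) = Σ_{P_θ(x)} (Q|Q′)·A_{QQ′}(x)` for `x ≥ 4`. -/
def PairForm : Prop :=
  ∀ θ : ℝ, 1 / 2 < θ → θ < 1 → ∀ x : ℕ, 4 ≤ x →
    J θ x = ∑ q ∈ pairs θ x, (jacobiSym (q.1 : ℤ) q.2 : ℝ) * (rootCount (q.1 * q.2) x : ℝ)

/-- STATEMENT 2 — the expected part cancels: `E_θ(x) = o(x)`. -/
def ExpectedPartCancels : Prop :=
  ∀ θ : ℝ, 1 / 2 < θ → θ < 1 → ∀ ε : ℝ, 0 < ε → ∀ᶠ x : ℕ in atTop, |Epart θ x| ≤ ε * x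

/-- STATEMENT 3 — the small-cofactor tail is peelable: `∀ ε ∃ μ, |D^{tail}_{θ,μ}(x)| ≤ εx` ev. -/
def SmallCofactorTail : Prop :=
  ∀ θ : ℝ, 1 / 2 < θ → θ < 1 → ∀ ε : ℝ, 0 < ε → ∃ μ : ℝ, 0 < μ ∧ μ < 1 ∧
    ∀ᶠ x : ℕ in atTop, |Dtail θ μ x| ≤ ε * x

/-- STATEMENT 4 — Poisson reduction: the tier Weyl bound controls the bulk discrepancy. -/
def PoissonReduction : Prop :=
  ∀ θ μ : ℝ, 1 / 2 < θ → θ < 1 → 0 < μ → μ < 1 → TierWeylBound θ μ →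
    ∀ ε : ℝ, 0 < ε → ∀ᶠ x : ℕ in atTop, |Dbulk θ μ x| ≤ ε * x

/-- STATEMENT 5 — the twisted root Weyl bound on the SHALLOW tiers `2/3 ≤ μ < 1` (saving `≤ N^{1/4}`;
contains the corner `μ ≥ 1 − δ₀`). -/
def WeylShallow : Prop :=
  ∀ θ μ : ℝ, 1 / 2 < θ → θ < 1 → 2 / 3 ≤ μ → μ < 1 → TierWeylBound θ μ

/-- STATEMENT 6 — the twisted root Weyl bound on the DEEP tiers `0 < μ < 2/3` (saving beyond the
cut-norm ceiling `N^{1/4}`, near `N^{1/2}` as `μ → 0`): the line's bet. -/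
def WeylDeep : Prop :=
  ∀ θ μ : ℝ, 1 / 2 < θ → θ < 1 → 0 < μ → μ < 2 / 3 → TierWeylBound θ μ

/-! ### §3 Registered stubs (`sorry` lives ONLY here; signatures = the statements above, expanded) -/

/-- **stub_pairForm** (size M; TRUE — finite combinatorics; the disprover's `J_eq_sum_pairs_mul_card`
is the same identity over an unfiltered pair set).  For `x ≥ 4` and `1 ≤ t ≤ x`: a prime `Q > x^θ ≥ 2`
dividing `t²+1` is odd with `−1` a square mod `Q`, hence `Q ≡ 1 (mod 4)` (`ZMod.exists_sq_eq_neg_one_iff`);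
two distinct such primes give `QQ′ ∣ t²+1 ≤ x²+1`; conversely a pair of `pairs θ x` with `QQ′ ∣ t²+1`
lies in `(t²+1).primeFactors²`.  So the inner filter of `J` equals `(pairs θ x).filter (QQ′ ∣ t²+1)`
for every `t`, and `Finset.sum_comm` + `Finset.sum_filter` + `Finset.card_eq_sum_ones` finish.
(`4 ≤ x` is needed: at `x = 3`, `θ < log 2/log 3` the pair `(2,5) ∣ 3²+1` is in `J` but not in `pairs`.)
Leans on: Mathlib `Nat.primeFactors`, `Nat.mem_primeFactors`, `Nat.Coprime.mul_dvd_of_dvd_of_dvd`,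
`ZMod.exists_sq_eq_neg_one_iff`, `Finset.sum_comm`, `Finset.sum_boole`. -/
theorem stub_pairForm :
    ∀ θ : ℝ, 1 / 2 < θ → θ < 1 → ∀ x : ℕ, 4 ≤ x →
      (∑ t ∈ Finset.Icc 1 x, ∑ q ∈ ((t ^ 2 + 1).primeFactors ×ˢ (t ^ 2 + 1).primeFactors).filter
          (fun q : ℕ × ℕ => (x : ℝ) ^ θ < (q.1 : ℝ) ∧ q.1 < q.2), (jacobiSym (q.1 : ℤ) q.2 : ℝ)) =
      ∑ q ∈ (Finset.range (x ^ 2 + 2) ×ˢ Finset.range (x ^ 2 + 2)).filter (fun q : ℕ × ℕ =>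
          q.1.Prime ∧ q.2.Prime ∧ q.1 % 4 = 1 ∧ q.2 % 4 = 1 ∧ (x : ℝ) ^ θ < (q.1 : ℝ) ∧ q.1 < q.2 ∧
            q.1 * q.2 ≤ x ^ 2 + 1),
        (jacobiSym (q.1 : ℤ) q.2 : ℝ) *
          ((((Finset.Icc 1 x).filter (fun t : ℕ => q.1 * q.2 ∣ t ^ 2 + 1)).card : ℕ) : ℝ) := by
  sorry

/-- **stub_expectedPart** (size L; TRUE — provable from TREE material, no unvendored fact).
`E_θ(x) = 4x·Σ_{P_θ(x)} (Q|Q′)/(QQ′)`; cut `(Q,Q′)` into dyadic boxes `(P₁,2P₁] × (P₂,2P₂]`,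
`x^θ/2 ≤ P₁ ≤ P₂ ≤ x²/P₁` (`O(log²x)` boxes).  (i) Boxes with `P₂ ≥ P₁·log⁵x`: `(Q|Q′) = χ_Q(Q′)`
with `χ_Q = (·|Q)` PRIMITIVE mod the prime `Q`; the multiplicative large sieve
(`Literature.NumberTheory.Sieve.largeSieve_character_nat`, one character per modulus `Q ≤ 2P₁`,
`a_n = 1_{n prime ≡ 1 (4)}` on `(P₂,2P₂]`) and Cauchy give
`Σ_Q |Σ_{Q′} (Q|Q′)| ≤ 2P₁^{3/2}P₂^{1/2} + 2P₁^{1/2}P₂`, a saving `≫ min((P₂/P₁)^{1/2}, P₁^{1/2})/log²`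
against the box mass `4x·#box/(P₁P₂) ≍ x/log²x`; summed: `O(x/log^{1.5}x)`.  (ii) Boxes with
`P₁ ≤ P₂ < P₁ log⁵x`: `O(log x · loglog x)` boxes of trivial mass `≤ 16x/(θ² log²x)`:
`O(x loglog x/log x)`.  (iii) Boxes cut by the hyperbola `QQ′ ≤ x²+1` or by `Q < Q′` (diagonal):
`O(log x)` boxes, trivial mass each (diagonal: symmetrise, `(Q|Q′) = (Q′|Q)` for `Q ≡ Q′ ≡ 1 (4)`,
Mathlib `jacobiSym.quadratic_reciprocity_one_mod_four`).  Total `o(x)`.  (Heath-Brown 1995 / FI 1998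
Prop. 21.3 would give `O(x^{1−θ/2+ε})`; not needed.)  CAVEAT (Disproof §H, triage r1-2 (b)): the true
size is `≍ x^{1−θ/2}/log²x` with a SIGN (Chebyshev bias; positive in balanced boxes) — irrelevant here.
Leans on: tree `largeSieve_character_nat` (LargeSieveCharacters.lean:315), Chebyshev/Mertens bounds for
primes in dyadic intervals (tree PNT layer / Mathlib `Nat.primeCounting`), Mathlib `jacobiSym`,
`DirichletCharacter`, `legendreSym` as a primitive character (`quadraticChar` of `ZMod Q`). -/
theorem stub_expectedPart :
    ∀ θ : ℝ, 1 / 2 < θ → θ < 1 → ∀ ε : ℝ, 0 < ε → ∀ᶠ x : ℕ in Filter.atTop,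
      |∑ q ∈ (Finset.range (x ^ 2 + 2) ×ˢ Finset.range (x ^ 2 + 2)).filter (fun q : ℕ × ℕ =>
          q.1.Prime ∧ q.2.Prime ∧ q.1 % 4 = 1 ∧ q.2 % 4 = 1 ∧ (x : ℝ) ^ θ < (q.1 : ℝ) ∧ q.1 < q.2 ∧
            q.1 * q.2 ≤ x ^ 2 + 1),
        (jacobiSym (q.1 : ℤ) q.2 : ℝ) * (4 * (x : ℝ) / ((q.1 * q.2 : ℕ) : ℝ))| ≤ ε * x := by
  sorry

/-- **stub_smallCofactorTail** (size L; TRUE — upper-bound sieve bookkeeping, the `m`-variable twin of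
card `split-mass-middle-prime`'s `SplitMassVanishes`).  `|D^{tail}| ≤ Σ_{P, QQ′ > x^{2−μ}} A_{QQ′}(x)
+ 4x Σ_{P, QQ′ > x^{2−μ}} 1/(QQ′)`.  Second sum: `Q′ ∈ (x^{2−μ}/Q, (x²+1)/Q]`, so by Mertens
`Σ_{Q′} 1/Q′ ≤ log((2−α)/(2−μ−α)) + o(1) ≤ 2μ + o(1)` (`Q = x^α`, `μ ≤ 1/2`), times `Σ_{x^θ<Q≤x} 1/Q
≤ log(1/θ) + o(1)`: `≤ C₁ μ x`.  First sum = MASS `#{(t,Q,Q′) : t ≤ x, QQ′ ∣ t²+1, QQ′ > x^{2−μ}}`: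
then `m := (t²+1)/(QQ′) < 2x^μ` and `(t²+1)/m` has no prime factor `≤ x^θ`; for each `m`, sifting the
`ρ(m)` root classes `t ≡ ν (mod m)` by the primes `p < x^γ`, `p ∤ m` (`γ = (1−μ)/3`, level `x^{2γ} ≤ x/m`)
with a Selberg/β upper bound gives `≤ C₂ x ρ(m) g(m)/(m γ log x) + ρ(m) x^{2γ}`
(`g(m) = Π_{p∣m}(1−2/p)^{-1}`), and `Σ_{m ≤ 2x^μ} ρ(m)g(m)/m ≤ C₃(μ log x + 1)`
(tree `abs_rhoLogSum_sub_le`-type Mertens sums for `ρ`): mass `≤ C₄ (μ/γ) x + o(x)`.  Given `ε`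
choose `μ := min(1/2, ε/(2(C₁ + 4C₄)))`.
Leans on: tree sieve layer (`Literature.NumberTheory.Sieve.SieveSequence`, `HasLevelOfDistribution`, the β-sieve
upper bound `Sieve.SieveSequence.sifted_le_of_dvd_primesProdBelow` (dimension 1), `BetaSieveSmallDimension`, `QuadraticRootCountLogSums`
(`abs_rhoLogSum_sub_le`), `IwaniecAlmostPrimesMertens.sum_rho_div_filter_le`), Mathlib Mertens
(`Nat.Primes` harmonic sums).  Uses `1/2 < θ` (at most 3 big primes per `t`). -/
theorem stub_smallCofactorTail :
    ∀ θ : ℝ, 1 / 2 < θ → θ < 1 → ∀ ε : ℝ, 0 < ε → ∃ μ : ℝ, 0 < μ ∧ μ < 1 ∧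
      ∀ᶠ x : ℕ in Filter.atTop,
        |∑ q ∈ ((Finset.range (x ^ 2 + 2) ×ˢ Finset.range (x ^ 2 + 2)).filter (fun q : ℕ × ℕ =>
            q.1.Prime ∧ q.2.Prime ∧ q.1 % 4 = 1 ∧ q.2 % 4 = 1 ∧ (x : ℝ) ^ θ < (q.1 : ℝ) ∧ q.1 < q.2 ∧
              q.1 * q.2 ≤ x ^ 2 + 1)).filter
            (fun q : ℕ × ℕ => ¬ ((q.1 * q.2 : ℕ) : ℝ) ≤ (x : ℝ) ^ (2 - μ)),
          (jacobiSym (q.1 : ℤ) q.2 : ℝ) *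
            (((((Finset.Icc 1 x).filter (fun t : ℕ => q.1 * q.2 ∣ t ^ 2 + 1)).card : ℕ) : ℝ) -
              4 * (x : ℝ) / ((q.1 * q.2 : ℕ) : ℝ))| ≤ ε * x := by
  sorry

/-- **stub_poissonReduction** (size L–XL; TRUE — standard analytic bookkeeping, the typed form of
triage r1-1's "dyadic lemma `MixedBilinear → CornerSplitBlock`", for ALL tiers at once).
Fix `θ, μ`, `TierWeylBound θ μ` with `(ε₀, x₀)`, and `ε > 0`.
(a) SMOOTHING: `w ∈ C_c^∞((0,1])`, `0 ≤ w ≤ 1`, `w = 1` on `[2η, 1−η]`; `A^w_q(x) := Σ_{q∣t²+1} w(t/x)`;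
since every `t ≤ x` carries `≤ 3` pairs (`x ≥ x₀(θ)`, Disproof §C) and `0 ≤ A_q − A^w_q`,
`|D^{bulk} − D^{w,bulk}| ≤ 9ηx + 6 + 12ηx(log(2/θ)+1)²` where `D^{w,bulk}` uses `A^w_q − 4xŵ(0)/q`.
(b) POISSON (`q = QQ′ > x^{2θ} > x`; Mathlib `Real.tsum_eq_tsum_fourierIntegral` /
`SchwartzMap.tsum_eq_tsum_fourierIntegral`): `A^w_q(x) − 4xŵ(0)/q = (x/q) Σ_{h≠0} ŵ(hx/q) S(h,q)`
(`ρ(q) = 4`: both primes `≡ 1 (4)`, distinct).  (c) TRUNCATION at `H_B = 4P₁P₂x^{ε₁−1}` per dyadic box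
`B` (`ε₁ < ε₀`; `|ŵ(ξ)| ≪_A (1+|ξ|)^{−A}`, `A = 1 + 5/ε₁`): total tail `O(1/x)`.  (d) SEPARATION: for
`h > 0`, `(x/q)ŵ(hx/q) = h^{-1} g(q/(hx))`, `g(u) = ŵ(1/u)/u`, `g̃(s) = M[ŵ](1−s)` rapidly decreasing
on `Re s = 1/2` (Mathlib `mellin_inversion`, pattern tree `IsSmoothBump.mellin_inversion`); the bulk cut
`QQ′ ≤ x^{2−μ}` by Perron (`T = x^{ε₁}`); the diagonal box by symmetrisation (`F(Q,Q′)` symmetric,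
`(Q|Q) = 0`); then partial summation in `Q` and in `Q′` reduces `Σ_{box} (Q|Q′)S(h,QQ′)(QQ′)^{-s}` to
`twistedSum h` over sub-intervals `(P₁,P₁'] × (P₂,P₂']`, at a cost `(1 + |s| log 2)²`.
(e) BOUND: box × frequency `h` costs `≤ C_w h^{-1}(hx/(P₁P₂))^{1/2} x^{1−ε₀}`; `Σ_{0<h≤H_B}` gives
`≤ 4C_w x^{ε₁/2} x^{1−ε₀}`; `O(log²x)` boxes and the Perron `log x`: `|D^{w,bulk}| ≤ C x^{1−ε₀+ε₁/2} log³x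
+ O(x^{1−ε₁/2})`.  With `η := ε/(2(21 + 12(log(2/θ)+1)²))` the claim follows for `x` large.
WHY `1/2 < θ` MATTERS: `q > x` makes the `h`-sum start at `H ≥ 1`; for `q < x` the zero frequency
dominates and nothing is claimed.  NO loss may be taken per pair before summing over pairs (there are
`≫ x^{2−μ} ≫ x` pairs): this is why the weight is separated by Mellin rather than frozen by Taylor.
Leans on: Mathlib Poisson summation, `mellin`/`mellin_inversion`, `Real.fourierIntegral` decay for
`ContDiff` compactly supported functions (`SchwartzMap`), `Finset.sum_Ioc_by_parts`-type Abel
summation (`Finset.sum_range_by_parts`); tree `Literature.Analysis.Fourier.*` smoothing kits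
(`SiegelZeroPrimePairsDyadicSmoothing` pattern).  Honours Disproof §A (`1/2 < θ` used here). -/
theorem stub_poissonReduction :
    ∀ θ μ : ℝ, 1 / 2 < θ → θ < 1 → 0 < μ → μ < 1 → TierWeylBound θ μ →
      ∀ ε : ℝ, 0 < ε → ∀ᶠ x : ℕ in atTop, |Dbulk θ μ x| ≤ ε * x := by
  sorry

/-- **stub_weylShallow** (size XL; OPEN but inside the range of coefficient-blind bilinear technology:
the required saving `N^{(1−μ)/(2−μ)+}` is `≤ N^{1/4}` for `μ ≥ 2/3`).  The corner `μ ≥ 1 − δ₀/3` is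
EXACTLY card `prime-pair-crt-corner`'s `MixedBilinear` (a power saving `(P₁P₂)^{−δ₀}` uniform in
`0 < |h| ≤ (P₁P₂)^{δ₀}` implies `TierWeylBound θ μ` for every `μ ≥ 1 − δ₀/3`: then `P₁P₂ ≤ x^{1+δ₀/3}`,
`(P₁P₂)^{1−δ₀} ≤ x^{1−δ₀/2}`, and `P₁P₂x^{ε₀−1} ≤ (P₁P₂)^{δ₀}` once `ε₀ ≤ δ₀/3`) — the engine on file:
Heath-Brown's duality for `(Q|Q′)` (Acta Arith. 72 (1995); FI 1998 Prop. 21.3) × Duke–Friedlander–Iwaniec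
1997 amplification for the Kloosterman fraction `e(h r Q̄′/Q)`; complete-sum model = a Salié sum
(Kowalski–Michel–Sawin 2017).  Between the corner and `μ = 2/3` the saving climbs to `N^{1/4}` — the
Cauchy–Schwarz/large-sieve ceiling (`Literature.Barriers.Parity.LargeSieveLevelHalf`: after Cauchy the
`Q′`-sum carries conductor `Q₁Q₂ ~ length²`).  Why it might fail: a secondary (Chebyshev-type) term at
some `h ≠ 0` of relative size `> N^{−1/4}` — none visible (`|T_h|/√N ≤ 3.45`, `h ≤ 2P+1`, `N ≤ 8.8·10⁶`;
triage r1-2/r1-3, kit j008654/j008680); degenerate rows `Q ∣ h` reduce to `2Σ_{Q′}(Q|Q′)S(h/Q,Q′)`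
(twisted DFI equidistribution over primes, fine on average).
Leans on: Mathlib `jacobiSym.quadratic_reciprocity_one_mod_four`, `ZMod.chineseRemainder` (CRT form of
`rootWeylSum`), tree `largeSieve_character_nat`, `Literature.NumberTheory.Sieve.QuadraticRoots*`
(root classes, DFI prime moduli); UNVENDORED: HeathBrown1995 (doi:10.4064/aa-72-3-235-275),
DFI1997 (doi:10.1007/s002220050135), BettinChandee (arXiv:1502.00769). -/
theorem stub_weylShallow :
    ∀ θ μ : ℝ, 1 / 2 < θ → θ < 1 → 2 / 3 ≤ μ → μ < 1 → TierWeylBound θ μ := by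
  sorry

/-- **stub_weylDeep** (size XL; OPEN, HARDEST — the line's exposure).  For `μ < 2/3` the required
saving `N^{(1−μ)/(2−μ)+}` exceeds `N^{1/4}`, which NO bound valid for general unit coefficients can
deliver (`‖((Q|Q′)S(h,QQ′))‖_{∞→1} ≥ c N^{3/4}` by Khintchine — recorded in the line card as a barrier
note): a proof must open the prime indicators in `Q` and `Q′` (Vaughan / Heath-Brown identity ⇒
tri- and quadrilinear sums of Legendre × Kloosterman-fraction kernels, Bettin–Chandee ranges) and, as
`μ → 0` (cofactor bounded, `q ≍ x²`, `H ≍ x` harmonics), reach within `x^{μ/2}` of SQUARE-ROOT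
cancellation — the triagers' "no engine beyond tier 1".  Why it is still the right residual: it is a
statement about FREE prime pairs and all `h` (density restored; the thin set `{t²+1}` is gone), its
`h`-aspect is a genuine equidistribution statement (roots of `-1` to the moduli `QQ′` weighted by the
spin `(Q|Q′)`, cf. Disproof §F), the random model and all numerics give `|T_h| ≍ √N`
(`≤ 3.45√N` up to `N = 8.8·10⁶`, balanced and `P₂ = 30P₁`), and no reciprocity constraint links
`(Q|Q′)` to the root positions (Disproof `exists_t_of_primes`; rattack: Rédei/Scholz bias killed).
Why it might fail: an arithmetic correlation between `(Q|Q′)` and `ν/(QQ′)` at some structured `h`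
(e.g. `h` a norm from `ℤ[i]`) of relative size `N^{−μ/(2(2−μ))}` — tiny, hence hard to exclude
numerically for small `μ`.  A lead should (i) land the implication `MixedBilinear → corner` inside
`stub_weylShallow`, (ii) push kit j008680 to unbalanced deep boxes (`P₁ = x^{0.55}`, `P₂ = x^{1.3}`,
`h` up to `x^{0.85}`), (iii) treat this stub as the place where round-2 ideas must bite.
Leans on: as `stub_weylShallow`; nothing in tree bears on it. -/
theorem stub_weylDeep :
    ∀ θ μ : ℝ, 1 / 2 < θ → θ < 1 → 0 < μ → μ < 2 / 3 → TierWeylBound θ μ := by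
  sorry

/-! ### §4 Consistency: each named statement IS its registered stub (definitionally) -/

theorem pairForm_holds : PairForm := stub_pairForm
theorem expectedPartCancels_holds : ExpectedPartCancels := stub_expectedPart
theorem smallCofactorTail_holds : SmallCofactorTail := stub_smallCofactorTail
theorem poissonReduction_holds : PoissonReduction := stub_poissonReduction
theorem weylShallow_holds : WeylShallow := stub_weylShallow
theorem weylDeep_holds : WeylDeep := stub_weylDeep

/-! ### §5 Name-keyed aliases of the six statements (hypotheses of the composition) -/
namespace Registered

/-- Alias of `PairForm` keyed by the registered stub name. -/
abbrev stub_pairForm : Prop := PairForm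
/-- Alias of `ExpectedPartCancels` keyed by the registered stub name. -/
abbrev stub_expectedPart : Prop := ExpectedPartCancels
/-- Alias of `SmallCofactorTail` keyed by the registered stub name. -/
abbrev stub_smallCofactorTail : Prop := SmallCofactorTail
/-- Alias of `PoissonReduction` keyed by the registered stub name. -/
abbrev stub_poissonReduction : Prop := PoissonReduction
/-- Alias of `WeylShallow` keyed by the registered stub name. -/
abbrev stub_weylShallow : Prop := WeylShallow
/-- Alias of `WeylDeep` keyed by the registered stub name. -/
abbrev stub_weylDeep : Prop := WeylDeep

end Registered

/-! ### §6 The composition: the six stubs imply the crux, BY NAME (kernel-checked, no `sorry`) -/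

/-- **`SplitBlockJacobi` from the six stubs** (pure bookkeeping + `ε/3`).  For `θ ∈ (1/2,1)` and
`c > 0`: `stub_smallCofactorTail` at `c/3` yields the tier `μ`; `stub_weylShallow` or `stub_weylDeep`
(according as `2/3 ≤ μ` or `μ < 2/3`) yields `TierWeylBound θ μ`; `stub_poissonReduction` bounds
`|D^{bulk}_{θ,μ}| ≤ (c/3)x`, `stub_expectedPart` bounds `|E_θ| ≤ (c/3)x`; by `stub_pairForm` and
`A_q = 4x/q + disc_q`, `J_θ = E_θ + D^{bulk}_{θ,μ} + D^{tail}_{θ,μ}` for `x ≥ 4`; triangle inequality. -/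
theorem SplitBlockJacobi_of (h₁ : Registered.stub_pairForm) (h₂ : Registered.stub_expectedPart)
    (h₃ : Registered.stub_smallCofactorTail) (h₄ : Registered.stub_poissonReduction)
    (h₅ : Registered.stub_weylShallow) (h₆ : Registered.stub_weylDeep) :
    Summit.Parity.BatemanHorn.Theses.IsogenyRedei.SplitBlockJacobi := by
  intro θ hθ₁ hθ₂
  rw [Asymptotics.isLittleO_iff]
  intro c hc
  have hc3 : 0 < c / 3 := by positivity
  obtain ⟨μ, hμ0, hμ1, hT⟩ := h₃ θ hθ₁ hθ₂ (c / 3) hc3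
  have hW : TierWeylBound θ μ := by
    by_cases h : (2 / 3 : ℝ) ≤ μ
    · exact h₅ θ μ hθ₁ hθ₂ h hμ1
    · exact h₆ θ μ hθ₁ hθ₂ hμ0 (not_le.mp h)
  have hB : ∀ᶠ x : ℕ in atTop, |Dbulk θ μ x| ≤ c / 3 * x := h₄ θ μ hθ₁ hθ₂ hμ0 hμ1 hW (c / 3) hc3
  have hE : ∀ᶠ x : ℕ in atTop, |Epart θ x| ≤ c / 3 * x := h₂ θ hθ₁ hθ₂ (c / 3) hc3
  filter_upwards [hT, hB, hE, eventually_ge_atTop 4] with x hxT hxB hxE hx4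
  -- the algebraic split `J = E + (D^bulk + D^tail)` at this `x`
  have hsplit : J θ x = Epart θ x + (Dbulk θ μ x + Dtail θ μ x) := by
    rw [h₁ θ hθ₁ hθ₂ x hx4]
    have hpt : ∀ q ∈ pairs θ x,
        (jacobiSym (q.1 : ℤ) q.2 : ℝ) * (rootCount (q.1 * q.2) x : ℝ) =
          (jacobiSym (q.1 : ℤ) q.2 : ℝ) * (4 * (x : ℝ) / ((q.1 * q.2 : ℕ) : ℝ)) +
            (jacobiSym (q.1 : ℤ) q.2 : ℝ) * disc (q.1 * q.2) x := by
      intro q _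
      unfold disc
      ring
    rw [Finset.sum_congr rfl hpt, Finset.sum_add_distrib]
    unfold Epart Dbulk Dtail
    congr 1
    exact (Finset.sum_filter_add_sum_filter_not _ _ _).symm
  show ‖J θ x‖ ≤ c * ‖(x : ℝ)‖
  rw [hsplit, Real.norm_eq_abs, Real.norm_eq_abs, Nat.abs_cast]
  have hA1 := abs_add_le (Epart θ x) (Dbulk θ μ x + Dtail θ μ x)
  have hA2 := abs_add_le (Dbulk θ μ x) (Dtail θ μ x)
  linarith

/-- Wiring check: the registered stubs feed `SplitBlockJacobi_of` as stated (the crux decl is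
inhabited modulo the six `sorry`s and nothing else). -/
theorem SplitBlockJacobi_of_stubs : Summit.Parity.BatemanHorn.Theses.IsogenyRedei.SplitBlockJacobi :=
  SplitBlockJacobi_of pairForm_holds expectedPartCancels_holds smallCofactorTail_holds
    poissonReduction_holds weylShallow_holds weylDeep_holds

/-! ### §7 Scratch checks (vocabulary sanity; `decide`/`norm_num`-sized) -/

/-- `13 = 2²·3 + 1`, `5 ∣ 3²+1 = 10`? no; `5 ∣ 2²+1`, `5 ∣ 3²+1`: `A_5(4) = #{2,3} = 2`. -/
example : rootCount 5 4 = 2 := by decide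

/-- The symbol between the two prime factors of `8² + 1 = 5·13` is `(5|13) = −1`
(Disproof `sign_neg` example; the Aurifeuillian `t = 2m²`, `m = 2 ≡ 2 (4)` family). -/
example : jacobiSym 5 13 = -1 := by norm_num

end Summit.Parity.BatemanHorn.Cruxes.SplitBlockJacobi.CofactorRootDiscrepancy

end
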